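import Mathlib.Analysis.Convex.Deriv
import Mathlib.Analysis.SpecialFunctions.Sqrt
import Mathlib.Analysis.Calculus.Deriv.Inv
import Mathlib.Analysis.Calculus.Deriv.Mul
import HarnessLib

/-!
# `NoHeavyLowerTail` (stmt-CriticalPhenomena-4575) — the mixing lemma for the three-point inequality (★★₃)
# `τ² + 2P² ≤ 3P·s`: along an apex edge `√(P(3s − 2P))` is CONCAVE, so the two endpoint inequalities interpolate

Support file (prover prim-ineq-gen-8 gen 53; `--supports stmt-CriticalPhenomena-4575`; memo
run/shared/lean/prim/prim-ineq-gen-8/FINDING-gen53-THREEPOINT.md §1).  No definitions, no named facts, no sorries.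

THE INEQUALITY (gen 51's (★★), conjectured there, numerically sharp): for bond percolation on a finite weighted graph, a (glued) apex
set `S` and vertices `u, b`, with `p = P(S~u)`, `q = P(S~b)`, `τ = P(S~u, S~b)`, `s = P(u↔b or both ~S)`, `P = pq`:
  `τ² + 3P² ≤ 4P·s`.
Gen 51 showed it is EQUIVALENT to the sharp two-load (V_w⁺) at `(S; u, b)` (`APL.vwPlus_twoLoad_iff_threePoint`) and that it implies
`P(S~u~b)² ≤ 4·P(S~u)P(S~b)P(u↔b)` (the published constant for general graphs is `8`: Gladkov, arXiv:2408.08457, Thm 6.2).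

THIS FILE: the analytic step of an induction on the number of edges (the percolation part is in `…APLThreePointAll.lean`).
Along one apex edge of weight `ζ ∈ [0,1]` the four probabilities are affine: `p(ζ) = p⁰ + ζδ_u`, `q(ζ) = q⁰ + ζδ_b`, `τ(ζ)`,
`s(ζ) = s⁰ + ζσ` with `δ_u, δ_b, σ ≥ 0` and the CROSS-ROW bound `σ ≤ p⁰δ_b + q⁰δ_u` (`APL.glued_increment_le`, a
van den Berg–Häggström–Kahn instance).  Put `P(ζ) = p(ζ)q(ζ)`, `Q(ζ) = P(ζ)(4s(ζ) − 3P(ζ))`; (★★) at `ζ` reads `τ(ζ)² ≤ Q(ζ)`.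
* `threePoint_concavity_numerator` — the KEY ALGEBRA: `2·Q·Q'' − (Q')² = −16(P₁s − Pσ)² + 8·P·P₂·(4s−3P)(2s−3P)` (`P₁ = P'`,
  `P₂ = δ_uδ_b`), and this is `≤ 0` whenever `σ ≤ P₁`, `s ≥ P ≥ 0` (case `2s ≤ 3P` trivially; else `P₁s − Pσ ≥ P₁(s−P) ≥ 0`,
  `P₁² ≥ 4PP₂` and `8(s−P)² − (4s−3P)(2s−3P) = P(2s−P) ≥ 0`).  Hence `√Q` is concave along the edge.
* **`threePoint_mixture`** — if (★★) holds at both endpoints (`ζ = 0`: the edge deleted; `ζ = 1`: its far end glued into `S`) then it holds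
  at every `ζ ∈ [0,1]`: `τ` is affine and `τ ≤ √Q` at the endpoints, so `τ(ζ) ≤ (1−ζ)√Q(0) + ζ√Q(1) ≤ √Q(ζ)` by concavity
  (`concaveOn_of_hasDerivWithinAt2_nonpos`).
[this work]
-/

noncomputable section

namespace Summit.CriticalPhenomena.PercolationContinuityZ3.Theorems

namespace APL

open Set

/-! ### The key algebra: `2QQ'' ≤ (Q')²` -/

/-- The polynomial identity behind the concavity of `√Q`, `Q = P(3s − 2P)`, `P = pq` (values and Taylor coefficients at one point:
`P₁ = pδ_b + qδ_u`, `P₂ = δ_uδ_b`, `s' = σ`):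
`2·Q·Q'' − (Q')² = −9(P₁s − Pσ)² + 4·P·P₂·(3s − 2P)(3s − 4P)`. [this work] -/
theorem threePoint_concavity_identity (p q du db s σ : ℝ) :
    2 * ((p * q) * (3 * s - 2 * (p * q)))
        * (2 * ((du * db) * (3 * s - 2 * (p * q)) + (p * db + q * du) * (3 * σ - 2 * (p * db + q * du))
            + (p * q) * (-2 * (du * db))))
      - ((p * db + q * du) * (3 * s - 2 * (p * q)) + (p * q) * (3 * σ - 2 * (p * db + q * du))) ^ 2
      = -9 * ((p * db + q * du) * s - (p * q) * σ) ^ 2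
        + 4 * (p * q) * (du * db) * (3 * s - 2 * (p * q)) * (3 * s - 4 * (p * q)) := by
  ring

/-- **`2QQ'' − (Q')² ≤ 0`** at a point where `p, q, δ_u, δ_b ≥ 0`, `σ ≤ pδ_b + qδ_u` and `s ≥ pq`. [this work] -/
theorem threePoint_concavity_numerator (p q du db s σ : ℝ) (hp : 0 ≤ p) (hq : 0 ≤ q) (hdu : 0 ≤ du) (hdb : 0 ≤ db)
    (hσ : σ ≤ p * db + q * du) (hs : p * q ≤ s) :
    2 * ((p * q) * (3 * s - 2 * (p * q)))
        * (2 * ((du * db) * (3 * s - 2 * (p * q)) + (p * db + q * du) * (3 * σ - 2 * (p * db + q * du))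
            + (p * q) * (-2 * (du * db))))
      - ((p * db + q * du) * (3 * s - 2 * (p * q)) + (p * q) * (3 * σ - 2 * (p * db + q * du))) ^ 2 ≤ 0 := by
  rw [threePoint_concavity_identity]
  set P := p * q with hP
  set P₁ := p * db + q * du with hP₁
  set P₂ := du * db with hP₂
  have hP0 : 0 ≤ P := mul_nonneg hp hq
  have hP₂0 : 0 ≤ P₂ := mul_nonneg hdu hdb
  have hP₁0 : 0 ≤ P₁ := by rw [hP₁]; positivity
  have hA : 0 ≤ 3 * s - 2 * P := by linarith
  have hAMGM : 4 * P * P₂ ≤ P₁ ^ 2 := by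
    rw [hP, hP₁, hP₂]; nlinarith [sq_nonneg (p * db - q * du)]
  have hsq : 0 ≤ (P₁ * s - P * σ) ^ 2 := sq_nonneg _
  by_cases hcase : 3 * s - 4 * P ≤ 0
  · have : 4 * P * P₂ * (3 * s - 2 * P) * (3 * s - 4 * P) ≤ 0 := by
      have h1 : 0 ≤ 4 * P * P₂ * (3 * s - 2 * P) := by positivity
      exact mul_nonpos_of_nonneg_of_nonpos h1 hcase
    linarith
  · push Not at hcase
    -- `P₁ s − P σ ≥ P₁ (s − P) ≥ 0`
    have hlow : P₁ * (s - P) ≤ P₁ * s - P * σ := by nlinarith [mul_le_mul_of_nonneg_left hσ hP0]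
    have hlow0 : 0 ≤ P₁ * (s - P) := mul_nonneg hP₁0 (by linarith)
    have hsq1 : (P₁ * (s - P)) ^ 2 ≤ (P₁ * s - P * σ) ^ 2 := pow_le_pow_left₀ hlow0 hlow 2
    -- `P₁² (s−P)² ≥ 4 P P₂ (s−P)²`
    have hsq2 : 4 * P * P₂ * (s - P) ^ 2 ≤ (P₁ * (s - P)) ^ 2 := by
      have := mul_le_mul_of_nonneg_right hAMGM (sq_nonneg (s - P))
      nlinarith [this]
    -- `36 P P₂ (s−P)² − 4 P P₂ (3s−2P)(3s−4P) = 4 P P₂ · P² ≥ 0`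
    have hfin : 4 * P * P₂ * (3 * s - 2 * P) * (3 * s - 4 * P) ≤ 36 * P * P₂ * (s - P) ^ 2 := by
      have hid : 36 * P * P₂ * (s - P) ^ 2 - 4 * P * P₂ * (3 * s - 2 * P) * (3 * s - 4 * P)
          = 4 * P * P₂ * P ^ 2 := by ring
      have hnn : 0 ≤ 4 * P * P₂ * P ^ 2 := by positivity
      linarith
    nlinarith

/-- Sign of the second derivative of `√Q`: with `r = √Q > 0` and `2QQ'' ≤ (Q')²`, the quotient-rule expression
`(Q''·2r − Q'·2(Q'/2r)) / (2r)²` is `≤ 0`. [this work] -/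
theorem threePoint_second_deriv_nonpos (Q Q' Q'' r : ℝ) (hss : r * r = Q) (hsq : 0 < r)
    (hkey : 2 * Q * Q'' - Q' ^ 2 ≤ 0) :
    (Q'' * (2 * r) - Q' * (2 * (Q' / (2 * r)))) / (2 * r) ^ 2 ≤ 0 := by
  have hrne : r ≠ 0 := ne_of_gt hsq
  have e1 : Q' * (2 * (Q' / (2 * r))) = Q' ^ 2 / r := by
    field_simp
  have e2 : Q'' * (2 * r) = (2 * Q * Q'') / r := by
    rw [eq_div_iff hrne, ← hss]; ring
  have hnum : Q'' * (2 * r) - Q' * (2 * (Q' / (2 * r))) ≤ 0 := by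
    rw [e1, e2, ← sub_div]
    exact div_nonpos_of_nonpos_of_nonneg hkey hsq.le
  exact div_nonpos_of_nonpos_of_nonneg hnum (sq_nonneg _)

/-! ### The mixing lemma -/

set_option maxHeartbeats 2000000 in
/-- **Mixing lemma for (★★).**  Endpoint data of the four probabilities along an apex edge — `tu, tb` (reach probabilities of `u, b`,
non-decreasing), `T` (both reached: `tu·tb ≤ T ≤ min(tu,tb)`, Harris and monotonicity), `G` (glued connection, `T ≤ G`, non-decreasing,
with the cross-row bound `G¹ − G⁰ ≤ tu⁰(tb¹−tb⁰) + tb⁰(tu¹−tu⁰)`) — and (★★₃) `T² + 2(tu·tb)² ≤ 3·tu·tb·G` at both endpoints imply (★★₃)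
for the affine interpolants at every `z ∈ [0,1]`.  Proof: `√(P(3G−2P))` is concave (second derivative, `threePoint_concavity_numerator`)
and dominates the affine `T` at the endpoints. [this work] -/
theorem threePoint_mixture (tu0 tu1 tb0 tb1 T0 T1 G0 G1 z : ℝ)
    (hu0 : 0 ≤ tu0) (hu : tu0 ≤ tu1) (hb0 : 0 ≤ tb0) (hb : tb0 ≤ tb1)
    (hT0 : 0 ≤ T0) (hT0u : T0 ≤ tu0) (hT1u : T1 ≤ tu1)
    (hH0 : tu0 * tb0 ≤ T0) (hH1 : tu1 * tb1 ≤ T1)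
    (hTG0 : T0 ≤ G0) (hTG1 : T1 ≤ G1) (hG : G0 ≤ G1)
    (hcross : G1 - G0 ≤ tu0 * (tb1 - tb0) + tb0 * (tu1 - tu0))
    (h0 : T0 ^ 2 + 2 * (tu0 * tb0) ^ 2 ≤ 3 * (tu0 * tb0) * G0)
    (h1 : T1 ^ 2 + 2 * (tu1 * tb1) ^ 2 ≤ 3 * (tu1 * tb1) * G1)
    (hz0 : 0 ≤ z) (hz1 : z ≤ 1) :
    ((1 - z) * T0 + z * T1) ^ 2 + 2 * (((1 - z) * tu0 + z * tu1) * ((1 - z) * tb0 + z * tb1)) ^ 2 ≤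
      3 * (((1 - z) * tu0 + z * tu1) * ((1 - z) * tb0 + z * tb1)) * ((1 - z) * G0 + z * G1) := by
  -- increments (as opaque reals with defining equations)
  obtain ⟨du, hdu⟩ : ∃ d : ℝ, d = tu1 - tu0 := ⟨_, rfl⟩
  obtain ⟨db, hdb⟩ : ∃ d : ℝ, d = tb1 - tb0 := ⟨_, rfl⟩
  obtain ⟨σ, hσ⟩ : ∃ d : ℝ, d = G1 - G0 := ⟨_, rfl⟩
  have hdu0 : 0 ≤ du := by rw [hdu]; linarith
  have hdb0 : 0 ≤ db := by rw [hdb]; linarith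
  have hσ0 : 0 ≤ σ := by rw [hσ]; linarith
  have hσle : σ ≤ tu0 * db + tb0 * du := by rw [hσ, hdu, hdb]; linarith
  have hT1 : 0 ≤ T1 := le_trans (mul_nonneg (le_trans hu0 hu) (le_trans hb0 hb)) hH1
  -- the affine interpolants and `Q`, as opaque functions with defining equations
  obtain ⟨pf, hpf_def⟩ : ∃ g : ℝ → ℝ, ∀ ζ, g ζ = tu0 + du * ζ := ⟨_, fun _ => rfl⟩
  obtain ⟨πf, hπf_def⟩ : ∃ g : ℝ → ℝ, ∀ ζ, g ζ = tb0 + db * ζ := ⟨_, fun _ => rfl⟩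
  obtain ⟨sf, hsf_def⟩ : ∃ g : ℝ → ℝ, ∀ ζ, g ζ = G0 + σ * ζ := ⟨_, fun _ => rfl⟩
  obtain ⟨Tf, hTf_def⟩ : ∃ g : ℝ → ℝ, ∀ ζ, g ζ = (1 - ζ) * T0 + ζ * T1 := ⟨_, fun _ => rfl⟩
  obtain ⟨Q, hQdef⟩ : ∃ g : ℝ → ℝ, ∀ ζ, g ζ = (pf ζ * πf ζ) * (3 * sf ζ - 2 * (pf ζ * πf ζ)) := ⟨_, fun _ => rfl⟩
  -- rewrite the goal in terms of `Q z` and `Tf z`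
  have epf : (1 - z) * tu0 + z * tu1 = pf z := by rw [hpf_def, hdu]; ring
  have eπf : (1 - z) * tb0 + z * tb1 = πf z := by rw [hπf_def, hdb]; ring
  have esf : (1 - z) * G0 + z * G1 = sf z := by rw [hsf_def, hσ]; ring
  have eTf : (1 - z) * T0 + z * T1 = Tf z := by rw [hTf_def]
  rw [epf, eπf, esf, eTf]
  suffices hmain : (Tf z) ^ 2 ≤ Q z by
    have : Q z = 3 * (pf z * πf z) * sf z - 2 * (pf z * πf z) ^ 2 := by rw [hQdef]; ring
    rw [this] at hmain
    linarith
  -- basic facts along the edge, valid for `ζ ∈ [0,1]`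
  have hpf : ∀ ζ, 0 ≤ ζ → tu0 ≤ pf ζ := fun ζ hζ => by rw [hpf_def]; nlinarith
  have hπf : ∀ ζ, 0 ≤ ζ → tb0 ≤ πf ζ := fun ζ hζ => by rw [hπf_def]; nlinarith
  have hpf0 : ∀ ζ, 0 ≤ ζ → 0 ≤ pf ζ := fun ζ hζ => le_trans hu0 (hpf ζ hζ)
  have hπf0 : ∀ ζ, 0 ≤ ζ → 0 ≤ πf ζ := fun ζ hζ => le_trans hb0 (hπf ζ hζ)
  -- `s(ζ) ≥ T(ζ) ≥ P(ζ)`: `T` is affine and lies above the chord of the convex `P`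
  have hTP : ∀ ζ, 0 ≤ ζ → ζ ≤ 1 → pf ζ * πf ζ ≤ Tf ζ := by
    intro ζ hζ0 hζ1
    have hchord : (1 - ζ) * (tu0 * tb0) + ζ * (tu1 * tb1) - pf ζ * πf ζ = ζ * (1 - ζ) * (du * db) := by
      rw [hpf_def, hπf_def, hdu, hdb]; ring
    have hnn : 0 ≤ ζ * (1 - ζ) * (du * db) := by
      have : 0 ≤ 1 - ζ := by linarith
      positivity
    have hch2 : (1 - ζ) * (tu0 * tb0) + ζ * (tu1 * tb1) ≤ Tf ζ := by
      rw [hTf_def]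
      have hζ1' : 0 ≤ 1 - ζ := by linarith
      nlinarith [mul_le_mul_of_nonneg_left hH0 hζ1', mul_le_mul_of_nonneg_left hH1 hζ0]
    linarith
  have hsT : ∀ ζ, 0 ≤ ζ → ζ ≤ 1 → Tf ζ ≤ sf ζ := by
    intro ζ hζ0 hζ1
    rw [hTf_def, hsf_def, hσ]
    have hζ1' : 0 ≤ 1 - ζ := by linarith
    nlinarith [mul_le_mul_of_nonneg_left hTG0 hζ1', mul_le_mul_of_nonneg_left hTG1 hζ0]
  have hsP : ∀ ζ, 0 ≤ ζ → ζ ≤ 1 → pf ζ * πf ζ ≤ sf ζ := fun ζ hζ0 hζ1 => le_trans (hTP ζ hζ0 hζ1) (hsT ζ hζ0 hζ1)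
  have hTf0 : ∀ ζ, 0 ≤ ζ → ζ ≤ 1 → 0 ≤ Tf ζ := by
    intro ζ hζ0 hζ1; rw [hTf_def]; have : 0 ≤ 1 - ζ := by linarith
    positivity
  have hQP : ∀ ζ, 0 ≤ ζ → ζ ≤ 1 → (pf ζ * πf ζ) ^ 2 ≤ Q ζ := by
    intro ζ hζ0 hζ1
    have hPz : 0 ≤ pf ζ * πf ζ := mul_nonneg (hpf0 ζ hζ0) (hπf0 ζ hζ0)
    have hsz := hsP ζ hζ0 hζ1
    rw [hQdef]
    nlinarith [mul_le_mul_of_nonneg_left hsz hPz]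
  have hQ0 : ∀ ζ, 0 ≤ ζ → ζ ≤ 1 → 0 ≤ Q ζ := fun ζ hζ0 hζ1 => le_trans (sq_nonneg _) (hQP ζ hζ0 hζ1)
  -- endpoint inequalities `T ≤ √Q`
  have hQat0 : Q 0 = 3 * (tu0 * tb0) * G0 - 2 * (tu0 * tb0) ^ 2 := by
    rw [hQdef, hpf_def, hπf_def, hsf_def]; ring
  have hQat1 : Q 1 = 3 * (tu1 * tb1) * G1 - 2 * (tu1 * tb1) ^ 2 := by
    rw [hQdef, hpf_def, hπf_def, hsf_def, hdu, hdb, hσ]; ring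
  have hE0 : T0 ≤ √(Q 0) := Real.le_sqrt_of_sq_le (by rw [hQat0]; linarith)
  have hE1 : T1 ≤ √(Q 1) := Real.le_sqrt_of_sq_le (by rw [hQat1]; linarith)
  -- DEGENERATE CASE: `p ≡ 0` or `π ≡ 0` on the edge (then `T ≡ 0`)
  by_cases hdeg : tu1 = 0 ∨ tb1 = 0
  · have hTz : Tf z = 0 := by
      rcases hdeg with h | h
      · have htu0 : tu0 = 0 := le_antisymm (h ▸ hu) hu0
        have hT0z : T0 = 0 := le_antisymm (htu0 ▸ hT0u) hT0
        have hT1z : T1 = 0 := le_antisymm (h ▸ hT1u) hT1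
        rw [hTf_def, hT0z, hT1z]; ring
      · have htb0 : tb0 = 0 := le_antisymm (h ▸ hb) hb0
        have hq0 : T0 ^ 2 ≤ 0 := by
          have h0' := h0
          rw [htb0] at h0'
          simpa using h0'
        have hq1 : T1 ^ 2 ≤ 0 := by
          have h1' := h1
          rw [h] at h1'
          simpa using h1'
        have hT0z : T0 = 0 := pow_eq_zero_iff (n := 2) (by norm_num) |>.1 (le_antisymm hq0 (sq_nonneg T0))
        have hT1z : T1 = 0 := pow_eq_zero_iff (n := 2) (by norm_num) |>.1 (le_antisymm hq1 (sq_nonneg T1))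
        rw [hTf_def, hT0z, hT1z]; ring
    rw [hTz]
    have hQz := hQ0 z hz0 hz1
    have h00 : (0 : ℝ) ^ 2 = 0 := by norm_num
    rw [h00]
    exact hQz
  -- MAIN CASE: `P > 0` on `(0,1)`
  push Not at hdeg
  obtain ⟨hu1ne, hb1ne⟩ := hdeg
  have hu1 : 0 < tu1 := lt_of_le_of_ne (le_trans hu0 hu) (Ne.symm hu1ne)
  have hb1 : 0 < tb1 := lt_of_le_of_ne (le_trans hb0 hb) (Ne.symm hb1ne)
  have hpfpos : ∀ ζ, 0 < ζ → ζ ≤ 1 → 0 < pf ζ := by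
    intro ζ hζ0 hζ1
    have hnn : 0 ≤ tu0 * (1 - ζ) := mul_nonneg hu0 (by linarith)
    have : ζ * tu1 ≤ pf ζ := by rw [hpf_def, hdu]; linarith
    exact lt_of_lt_of_le (mul_pos hζ0 hu1) this
  have hπfpos : ∀ ζ, 0 < ζ → ζ ≤ 1 → 0 < πf ζ := by
    intro ζ hζ0 hζ1
    have hnn : 0 ≤ tb0 * (1 - ζ) := mul_nonneg hb0 (by linarith)
    have : ζ * tb1 ≤ πf ζ := by rw [hπf_def, hdb]; linarith
    exact lt_of_lt_of_le (mul_pos hζ0 hb1) this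
  have hQpos : ∀ ζ, 0 < ζ → ζ < 1 → 0 < Q ζ := by
    intro ζ hζ0 hζ1
    have hPz : 0 < pf ζ * πf ζ := mul_pos (hpfpos ζ hζ0 hζ1.le) (hπfpos ζ hζ0 hζ1.le)
    exact lt_of_lt_of_le (pow_pos hPz 2) (hQP ζ hζ0.le hζ1.le)
  -- derivatives of `Q`
  obtain ⟨P1, hP1⟩ : ∃ g : ℝ → ℝ, ∀ ζ, g ζ = pf ζ * db + πf ζ * du := ⟨_, fun _ => rfl⟩
  obtain ⟨Q', hQ'⟩ : ∃ g : ℝ → ℝ, ∀ ζ, g ζ = P1 ζ * (3 * sf ζ - 2 * (pf ζ * πf ζ)) + (pf ζ * πf ζ) * (3 * σ - 2 * P1 ζ) :=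
    ⟨_, fun _ => rfl⟩
  obtain ⟨Q'', hQ''⟩ : ∃ g : ℝ → ℝ, ∀ ζ, g ζ = 2 * ((du * db) * (3 * sf ζ - 2 * (pf ζ * πf ζ)) + P1 ζ * (3 * σ - 2 * P1 ζ)
      + (pf ζ * πf ζ) * (-2 * (du * db))) := ⟨_, fun _ => rfl⟩
  have hpf_fun : pf = fun x => tu0 + du * x := funext hpf_def
  have hπf_fun : πf = fun x => tb0 + db * x := funext hπf_def
  have hsf_fun : sf = fun x => G0 + σ * x := funext hsf_def
  have hdp : ∀ ζ, HasDerivAt pf du ζ := by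
    intro ζ
    rw [hpf_fun]
    have h := ((hasDerivAt_id' ζ).const_mul du).const_add tu0
    exact h.congr_deriv (by ring)
  have hdπ : ∀ ζ, HasDerivAt πf db ζ := by
    intro ζ
    rw [hπf_fun]
    have h := ((hasDerivAt_id' ζ).const_mul db).const_add tb0
    exact h.congr_deriv (by ring)
  have hds : ∀ ζ, HasDerivAt sf σ ζ := by
    intro ζ
    rw [hsf_fun]
    have h := ((hasDerivAt_id' ζ).const_mul σ).const_add G0
    exact h.congr_deriv (by ring)
  have hdP : ∀ ζ, HasDerivAt (fun x => pf x * πf x) (P1 ζ) ζ := by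
    intro ζ
    have h := (hdp ζ).mul (hdπ ζ)
    refine h.congr_deriv ?_
    rw [hP1]; ring
  have hdA : ∀ ζ, HasDerivAt (fun x => 3 * sf x - 2 * (pf x * πf x)) (3 * σ - 2 * P1 ζ) ζ := fun ζ =>
    ((hds ζ).const_mul 3).sub ((hdP ζ).const_mul 2)
  have hQfun : Q = fun x => (pf x * πf x) * (3 * sf x - 2 * (pf x * πf x)) := funext hQdef
  have hdQ : ∀ ζ, HasDerivAt Q (Q' ζ) ζ := by
    intro ζ
    have h := (hdP ζ).mul (hdA ζ)
    rw [hQfun]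
    refine h.congr_deriv ?_
    rw [hQ']
  have hP1fun : P1 = fun x => pf x * db + πf x * du := funext hP1
  have hdP1 : ∀ ζ, HasDerivAt P1 (2 * (du * db)) ζ := by
    intro ζ
    have h := ((hdp ζ).mul_const db).add ((hdπ ζ).mul_const du)
    rw [hP1fun]
    exact h.congr_deriv (by ring)
  have hQ'fun : Q' = fun x => P1 x * (3 * sf x - 2 * (pf x * πf x)) + (pf x * πf x) * (3 * σ - 2 * P1 x) := funext hQ'
  have hdQ' : ∀ ζ, HasDerivAt Q' (Q'' ζ) ζ := by
    intro ζ
    have hB : HasDerivAt (fun x => 3 * σ - 2 * P1 x) (0 - 2 * (2 * (du * db))) ζ :=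
      (hasDerivAt_const ζ (3 * σ)).sub ((hdP1 ζ).const_mul 2)
    have h := ((hdP1 ζ).mul (hdA ζ)).add ((hdP ζ).mul hB)
    rw [hQ'fun]
    refine h.congr_deriv ?_
    rw [hQ'']; ring
  -- `√Q` and its two derivatives on `(0,1)`
  have hdf : ∀ ζ, 0 < ζ → ζ < 1 → HasDerivAt (fun x => √(Q x)) (Q' ζ / (2 * √(Q ζ))) ζ := fun ζ hζ0 hζ1 =>
    (hdQ ζ).sqrt (ne_of_gt (hQpos ζ hζ0 hζ1))
  have hdf' : ∀ ζ, 0 < ζ → ζ < 1 → HasDerivAt (fun x => Q' x / (2 * √(Q x)))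
      ((Q'' ζ * (2 * √(Q ζ)) - Q' ζ * (2 * (Q' ζ / (2 * √(Q ζ))))) / (2 * √(Q ζ)) ^ 2) ζ := by
    intro ζ hζ0 hζ1
    have hsq : 0 < √(Q ζ) := Real.sqrt_pos.2 (hQpos ζ hζ0 hζ1)
    have hne : 2 * √(Q ζ) ≠ 0 := by positivity
    exact (hdQ' ζ).div ((hdf ζ hζ0 hζ1).const_mul 2) hne
  -- sign of the second derivative
  have hf''le : ∀ ζ, 0 < ζ → ζ < 1 →
      (Q'' ζ * (2 * √(Q ζ)) - Q' ζ * (2 * (Q' ζ / (2 * √(Q ζ))))) / (2 * √(Q ζ)) ^ 2 ≤ 0 := by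
    intro ζ hζ0 hζ1
    have hQp := hQpos ζ hζ0 hζ1
    have hkey : 2 * Q ζ * Q'' ζ - Q' ζ ^ 2 ≤ 0 := by
      have a1 : tu0 * db ≤ pf ζ * db := mul_le_mul_of_nonneg_right (hpf ζ hζ0.le) hdb0
      have a2 : tb0 * du ≤ πf ζ * du := mul_le_mul_of_nonneg_right (hπf ζ hζ0.le) hdu0
      have hσ' : σ ≤ pf ζ * db + πf ζ * du := by linarith [hσle, a1, a2]
      have hnum := threePoint_concavity_numerator (pf ζ) (πf ζ) du db (sf ζ) σ (hpf0 ζ hζ0.le) (hπf0 ζ hζ0.le) hdu0 hdb0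
        hσ' (hsP ζ hζ0.le hζ1.le)
      rw [hQ'', hQ', hP1, hQdef]
      exact hnum
    exact threePoint_second_deriv_nonpos (Q ζ) (Q' ζ) (Q'' ζ) (√(Q ζ)) (Real.mul_self_sqrt hQp.le) (Real.sqrt_pos.2 hQp) hkey
  -- concavity of `√Q` on `[0,1]`
  have hcont : ContinuousOn (fun x => √(Q x)) (Icc 0 1) := by
    have hQc : Continuous Q := by
      rw [hQfun, hpf_fun, hπf_fun, hsf_fun]
      fun_prop
    exact (Real.continuous_sqrt.comp hQc).continuousOn
  have hconc : ConcaveOn ℝ (Icc (0 : ℝ) 1) (fun x => √(Q x)) := by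
    refine concaveOn_of_hasDerivWithinAt2_nonpos (convex_Icc 0 1) (f' := fun ζ => Q' ζ / (2 * √(Q ζ)))
      (f'' := fun ζ => (Q'' ζ * (2 * √(Q ζ)) - Q' ζ * (2 * (Q' ζ / (2 * √(Q ζ))))) / (2 * √(Q ζ)) ^ 2) hcont ?_ ?_ ?_
    · intro x hx
      rw [interior_Icc] at hx ⊢
      exact (hdf x hx.1 hx.2).hasDerivWithinAt
    · intro x hx
      rw [interior_Icc] at hx ⊢
      exact (hdf' x hx.1 hx.2).hasDerivWithinAt
    · intro x hx
      rw [interior_Icc] at hx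
      exact hf''le x hx.1 hx.2
  -- the chord inequality and the conclusion
  have hch := hconc.2 (left_mem_Icc.2 zero_le_one) (right_mem_Icc.2 zero_le_one) (by linarith : 0 ≤ 1 - z) hz0 (by ring)
  simp only [smul_eq_mul, mul_zero, mul_one, zero_add] at hch
  have hTle : Tf z ≤ √(Q z) := by
    have hζ1' : 0 ≤ 1 - z := by linarith
    have step : Tf z ≤ (1 - z) * √(Q 0) + z * √(Q 1) := by
      rw [hTf_def]
      nlinarith [mul_le_mul_of_nonneg_left hE0 hζ1', mul_le_mul_of_nonneg_left hE1 hz0]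
    exact le_trans step hch
  calc Tf z ^ 2 ≤ (√(Q z)) ^ 2 := pow_le_pow_left₀ (hTf0 z hz0 hz1) hTle 2
    _ = Q z := Real.sq_sqrt (hQ0 z hz0 hz1)

end APL

end Summit.CriticalPhenomena.PercolationContinuityZ3.Theorems

end
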